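import Literature.Combinatorics.Sahi2008.TotalOrder
import Literature.Combinatorics.Sahi2008.ProductOfChains
import Summits.CriticalPhenomena.PercolationContinuityZ3.Theorems.PercNearOneGluingNoHeavyLowerTailSahiTangentDisjointSlot

/-!
# `NoHeavyLowerTail` (crux stmt-CriticalPhenomena-4575), Sahi programme: **THE CONTRACTION / TANGENT INEQUALITY AT EVERY ORDER** —
# `E_n^{B_p ⊗ μ}(F) ≥ p · E_n^{μ}(F | top)` for every `n`, every `p ∈ [0,1]`, every probability weight on every finite CHAIN
# (the 'tangent Blinovsky conjecture' of prim-sahi-p2 gen 32), and the MINIMAL-BOTTOM THEOREM behind it on arbitrary preorders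

Support file (Sahi cell, seat `prim-sahi-p1`, generation 47; `--supports stmt-CriticalPhenomena-4575`); part 2 of 2 (part 1:
`…SahiTangentDisjointSlot`, Lemma D and the coin bookkeeping).  Pure proofs, NO definitions, no `sorry`, standard axioms.  Vocabulary: `sahiE`, `ex`, `SahiPositive`, `setInd` of `Literature/Combinatorics/Sahi2008`; the coin-product
weight on `Bool × α` is written, as in the companion `…SahiTangentChain` (prim-sahi-p2 gen 32, the order-3 case),
`B_p ⊗ μ = fun z => if z.1 then p * μ z.2 else (1 - p) * μ z.2`, and an increasing function of `Bool × α` in slot `l` as the pair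
`F_l(ε,x) = (ε ? t_l x : b_l x)` of its top and bottom sections `b_l ≤ t_l`.

THE MATHEMATICS.  For functions `F_l = (b_l, t_l)` on `Bool × α` write `X_B = E_μ Π_{l∈B} t_l`, `Y_B = E_μ Π_{l∈B} b_l` (`B ⊆ [n]`).
`p ↦ E_n^{B_p⊗μ}(F) = Σ_π c_π Π_{B∈π} (p X_B + (1−p) Y_B)` is a polynomial of degree `≤ n`; the order-`n` TANGENT inequality of the
p2 memo FROM-prim-sahi-p2-gen32-TANGENT (`T_n := E_n(1) − E_n'(1) ≥ 0`; `n = 3` ⟺ the increasing-star inequality R23 read on a general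
lattice) is, by the edge-subdivision remark there, equivalent over a class closed under `· × Bool` to the CONTRACTION form
`E_n^{B_p⊗μ}(F) ≥ p · E_n^{μ}(t)` for all `p` (`p ↦ E_n/p` non-increasing).  Two observations prove it at every order:
(1) `E_n` is LINEAR in the group of moments through a fixed slot `i`, with coefficients `∂E_n/∂X_B = −(|B|−1)!·E_{n−|B|}(t|_{B^c})`
(`i ∈ B ≠ [n]`) and `(n−1)!` (`B = [n]`) — so, as long as the weight is Sahi-positive at the lower orders, RAISING the bottom `b_i` of a slot
towards its top can only LOWER `E_n^{B_p⊗μ}(F)`, except through the top moment `Y_{[n]}`; in function language (no moments needed):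
**a nonnegative slot whose product with the other (monotone, nonnegative) slots vanishes identically makes `E_n` nonpositive**
(`sahiE_nonpos_of_prod_eq_zero`, induction through the Lieb–Sahi recursion), applied to the increment `(1−ε)(t_i − b_i)`, which is
disjoint from the product of the other slots as soon as some OTHER slot `j` has a bottom below `b_i`'s defect: `b_j·b_i = b_j·t_i`
(`sahiE_pair_raise_le`).  (2) If slot `j` has a MINIMAL bottom (`b_j·b_i = b_j·t_i` for all `i`; indicators: `U_j⁰ ⊆ U_i⁰`), raising all
other bottoms leaves the single-defect family, whose functional is, by linearity in slot `j`, EXACTLY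
`p·E_n^{μ}(t) + (1−p)·E_n^{μ}(t_0,…,b_j,…,t_{n−1})` (`sahiE_coin_single_defect`; marginalisation `sahiE_coin_snd` and top-layer scaling
`sahiE_coin_top`).  Hence

  **THEOREM A (`sahiE_coin_ge_of_minimal_bottom`, every `n`).**  `α` a finite preorder, `μ ≥ 0`, `p ∈ [0,1]` with `B_p ⊗ μ` Sahi-positive
  of every order on `Bool × α`; `b_l ≤ t_l` monotone nonnegative with a minimal bottom at slot `j`.  Then
  `p·E_n^{μ}(t) + (1−p)·E_n^{μ}(t[j ← b_j]) ≤ E_n^{B_p⊗μ}(F)`; with `μ` Sahi-positive at order `n` the second term is `≥ 0`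
  (`sahiE_coin_ge_mul_top_of_minimal_bottom`: `p·E_n^{μ}(t) ≤ E_n^{B_p⊗μ}(F)`).

  **COROLLARY (`sahiE_coin_chain_ge`: the tangent analogue of Blinovsky's lemma, every order).**  On a finite CHAIN the bottoms `U_l⁰`
  are nested, so a minimal one exists; `μ` is Sahi-positive of every order (Blinovsky, `sahiPositive_of_linearOrder`) and so is `B_p ⊗ μ`
  (a product weight on a product of two chains, `ProductChains.sahiPositive_prodWeight_linearOrder`): for EVERY probability weight `μ`,
  every `p ∈ [0,1]`, every `n` and all up-sets `U_l⁰ ⊆ U_l¹`,  `p · E_n^{μ}(χ_{U¹}) ≤ E_n^{B_p⊗μ}(F_U)`.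
  (`n = 3`: the tree's `sahiE_three_coin_chain_ge`, there by fifteen polynomial certificates; the p2 memo §9(b) had checked the gap-positive
  form for `n ≤ 4` and conjectured all `n`.)

By multilinearity and the finite layer cake the statement extends from up-set indicators to all nonnegative increasing `F_l` on `Bool × α`;
this routine step is not spelled out.  HONEST LABEL: the general 'Conjecture T' of the p2 memo (arbitrary FKG lattice `L × Bool`, bottoms NOT
nested — the percolation case R23 is of this kind) is NOT proved here and remains open; Theorem A covers exactly the configurations with a
minimal bottom slot (in percolation: an edge `g` and a target `t_j` such that in `G − g` every open path from the root to `t_j` meets one of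
the other targets).  Nothing is asserted about Sahi's `C_n`, Kahn's conjecture or the increasing star. [this work]
-/

namespace Summit.CriticalPhenomena.PercolationContinuityZ3.Theorems.SahiTangent

open Finset Function Literature.Combinatorics.Sahi2008
open scoped BigOperators

/-! ### Pair families on `Bool × α`: raising a bottom lowers `E_n` when some other bottom is minimal -/

section Raise

variable {α : Type*} [Fintype α] [Preorder α]

omit [Fintype α] in
/-- An up-set pair `(b ≤ t)` of monotone functions gives a monotone function `(ε, x) ↦ (ε ? t x : b x)` on `Bool × α`. [this work] -/
theorem monotone_pairFun {b t : α → ℝ} (hb : Monotone b) (ht : Monotone t) (hbt : ∀ x, b x ≤ t x) :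
    Monotone (fun z : Bool × α => if z.1 then t z.2 else b z.2) := by
  intro z w hzw
  rcases z with ⟨c, x⟩
  rcases w with ⟨d, y⟩
  obtain ⟨h1, h2⟩ := Prod.mk_le_mk.1 hzw
  cases c <;> cases d
  · simpa using hb h2
  · simpa using (hb h2).trans (hbt y)
  · exact absurd h1 (by decide)
  · simpa using ht h2

omit [Fintype α] [Preorder α] in
/-- The coin weight `B_p ⊗ μ` is nonnegative for `p ∈ [0,1]`, `μ ≥ 0`. [this work] -/
theorem coin_nonneg {μ : α → ℝ} (hμ₀ : ∀ x, 0 ≤ μ x) {p : ℝ} (hp₀ : 0 ≤ p) (hp₁ : p ≤ 1) (z : Bool × α) :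
    0 ≤ (fun z : Bool × α => if z.1 then p * μ z.2 else (1 - p) * μ z.2) z := by
  rcases z with ⟨c, x⟩
  cases c
  · simpa using mul_nonneg (sub_nonneg.2 hp₁) (hμ₀ x)
  · simpa using mul_nonneg hp₀ (hμ₀ x)

/-- **Raising one bottom lowers `E_n`.**  Pair families `F_l(ε,x) = (ε ? t_l x : b_l x)` on `Bool × α` under a weight `ρ` on `Bool × α`
that is `≥ 0` and Sahi-positive of every order (e.g. `B_p ⊗ μ` on `Bool × chain`).  If slot `j ≠ i` has `b_j·b_i = b_j·t_i` (on the support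
of the bottom of slot `j` the pair of slot `i` has no defect), then replacing the bottom `b_i` by the top `t_i` does not increase `E_n`:
the difference is `E_n` of the family with `(1−ε)(t_i − b_i)` in slot `i`, a nonnegative slot disjoint from the product of the others.
(`b₂` is the raised family, described pointwise.) [this work] -/
theorem sahiE_pair_raise_le {ρ : Bool × α → ℝ} (hρ₀ : ∀ z, 0 ≤ ρ z) (hpos : ∀ k, SahiPositive ρ k) {n : ℕ}
    (b b₂ t : Fin (n + 2) → α → ℝ) (hb0 : ∀ l x, 0 ≤ b l x) (hbt : ∀ l x, b l x ≤ t l x) (hbm : ∀ l, Monotone (b l))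
    (htm : ∀ l, Monotone (t l)) {i j : Fin (n + 2)} (hij : i ≠ j) (hmin : ∀ x, b j x * b i x = b j x * t i x)
    (hb₂i : ∀ x, b₂ i x = t i x) (hb₂ : ∀ l, l ≠ i → ∀ x, b₂ l x = b l x) :
    sahiE ρ (n + 2) (fun l (z : Bool × α) => if z.1 then t l z.2 else b₂ l z.2) ≤
      sahiE ρ (n + 2) (fun l (z : Bool × α) => if z.1 then t l z.2 else b l z.2) := by
  set F : Fin (n + 2) → Bool × α → ℝ := fun l z => if z.1 then t l z.2 else b l z.2 with hF
  set φ : Bool × α → ℝ := fun z => if z.1 then 0 else t i z.2 - b i z.2 with hφ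
  have e1 : (fun l (z : Bool × α) => if z.1 then t l z.2 else b₂ l z.2) = update F i (F i + φ) := by
    funext l z
    by_cases hl : l = i
    · subst hl
      rw [update_self, Pi.add_apply, hF, hφ]
      rcases z with ⟨c, x⟩
      cases c
      · simp [hb₂i]
      · simp
    · rw [update_of_ne hl, hF]
      rcases z with ⟨c, x⟩
      cases c
      · simp [hb₂ l hl]
      · simp
  rw [e1, sahiE_update_add, update_eq_self]
  suffices h : sahiE ρ (n + 2) (update F i φ) ≤ 0 by linarith
  refine sahiE_nonpos_of_prod_eq_zero' hρ₀ hpos (update F i φ) i ?_ ?_ ?_ ?_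
  · intro z
    rw [update_self, hφ]
    rcases z with ⟨c, x⟩
    cases c
    · simpa using hbt i x
    · simp
  · intro l hl z
    rw [update_of_ne hl, hF]
    rcases z with ⟨c, x⟩
    cases c
    · simpa using hb0 l x
    · simpa using (hb0 l x).trans (hbt l x)
  · intro l hl
    rw [update_of_ne hl, hF]
    exact monotone_pairFun (hbm l) (htm l) (hbt l)
  · intro z
    rw [Fin.prod_univ_succAbove _ i, update_self]
    simp_rw [update_of_ne (Fin.succAbove_ne i _)]
    rcases z with ⟨c, x⟩
    cases c
    · obtain ⟨k₀, hk₀⟩ := Fin.exists_succAbove_eq hij.symm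
      rw [Fin.prod_univ_succAbove _ k₀, hk₀, hF, hφ]
      simp only [Bool.false_eq_true, if_false]
      have h' : (t i x - b i x) * b j x = 0 := by linear_combination (-1 : ℝ) * hmin x
      rw [← mul_assoc, h', zero_mul]
    · rw [hφ]
      simp

/-- **Raising all bottoms outside slot `j`** (iterate the previous lemma over a finset `S ∌ j` of slots): with a minimal bottom at `j`
(`b_j·b_i = b_j·t_i` for all `i`), the family with bottoms raised to tops on `S` has `E_n` at most that of the original family.
[this work] -/
theorem sahiE_pair_raise_finset_le {ρ : Bool × α → ℝ} (hρ₀ : ∀ z, 0 ≤ ρ z) (hpos : ∀ k, SahiPositive ρ k) {n : ℕ}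
    (b t : Fin (n + 2) → α → ℝ) (hb0 : ∀ l x, 0 ≤ b l x) (hbt : ∀ l x, b l x ≤ t l x) (hbm : ∀ l, Monotone (b l))
    (htm : ∀ l, Monotone (t l)) (j : Fin (n + 2)) (hmin : ∀ i x, b j x * b i x = b j x * t i x) :
    ∀ S : Finset (Fin (n + 2)), j ∉ S →
      sahiE ρ (n + 2) (fun l (z : Bool × α) => if z.1 then t l z.2 else (if l ∈ S then t l else b l) z.2) ≤
        sahiE ρ (n + 2) (fun l (z : Bool × α) => if z.1 then t l z.2 else b l z.2) := by
  intro S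
  induction S using Finset.induction_on with
  | empty =>
    intro _
    simp only [Finset.notMem_empty, if_false, le_refl]
  | insert i S hiS ih =>
    intro hj
    rw [Finset.mem_insert, not_or] at hj
    obtain ⟨hji, hjS⟩ := hj
    -- the family raised on `S`
    set b' : Fin (n + 2) → α → ℝ := fun l => if l ∈ S then t l else b l with hb'
    have hb'0 : ∀ l x, 0 ≤ b' l x := by
      intro l x; rw [hb']; dsimp only; split_ifs
      · exact (hb0 l x).trans (hbt l x)
      · exact hb0 l x
    have hb't : ∀ l x, b' l x ≤ t l x := by
      intro l x; rw [hb']; dsimp only; split_ifs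
      · exact le_rfl
      · exact hbt l x
    have hb'm : ∀ l, Monotone (b' l) := by
      intro l; rw [hb']; dsimp only; split_ifs
      · exact htm l
      · exact hbm l
    have hb'j : b' j = b j := by rw [hb']; dsimp only; rw [if_neg hjS]
    have hb'i : b' i = b i := by rw [hb']; dsimp only; rw [if_neg hiS]
    have hmin' : ∀ x, b' j x * b' i x = b' j x * t i x := by
      intro x; rw [hb'j, hb'i]; exact hmin i x
    have step := sahiE_pair_raise_le hρ₀ hpos b' (fun l => if l ∈ insert i S then t l else b l) t hb'0 hb't hb'm htm
      (Ne.symm hji) hmin' (fun x => by simp) (fun l hl x => by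
        rw [hb']; dsimp only; simp [Finset.mem_insert, hl])
    exact step.trans (ih hjS)

omit [Preorder α] in
/-- **Evaluation of the single-defect family.**  If only slot `j` has a bottom different from its top, then
`E_n^{B_p⊗μ}(F) = p·E_n^{μ}(t) + (1−p)·E_n^{μ}(t[j ← b_j])` (any real `p`; linearity in slot `j`, marginalisation and top-layer
scaling). [this work] -/
theorem sahiE_coin_single_defect (μ : α → ℝ) (p : ℝ) {n : ℕ} (t : Fin n → α → ℝ) (j : Fin n) (bj : α → ℝ) :
    sahiE (fun z : Bool × α => if z.1 then p * μ z.2 else (1 - p) * μ z.2) n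
        (fun l (z : Bool × α) => if z.1 then t l z.2 else update t j bj l z.2) =
      p * sahiE μ n t + (1 - p) * sahiE μ n (update t j bj) := by
  have e1 : (fun l (z : Bool × α) => if z.1 then t l z.2 else update t j bj l z.2) =
      update (fun l (z : Bool × α) => t l z.2) j ((fun z : Bool × α => bj z.2) + fun z : Bool × α => if z.1 then (t j - bj) z.2 else 0) := by
    funext l z
    by_cases hl : l = j
    · subst hl
      rw [update_self, update_self, Pi.add_apply]
      rcases z with ⟨c, x⟩
      cases c <;> simp
    · rw [update_of_ne hl, update_of_ne hl]
      rcases z with ⟨c, x⟩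
      cases c <;> simp
  rw [e1, sahiE_update_add, ← lift_update, sahiE_coin_snd, sahiE_coin_top]
  have e2 : sahiE μ n (update t j (t j - bj)) = sahiE μ n t - sahiE μ n (update t j bj) := by
    have h := sahiE_update_add μ t j (t j - bj) bj
    rw [sub_add_cancel, update_eq_self] at h
    linarith
  rw [e2]
  ring

/-- **THEOREM A (the contraction inequality with a minimal bottom slot, every order `n`).**  Let `μ ≥ 0` be a weight on a finite preorder `α`
and `p ∈ [0,1]` such that the coin product `B_p ⊗ μ` on `Bool × α` is Sahi-positive of every order (for `α` a chain this is the
product-of-two-chains theorem).  Let `b_l ≤ t_l` (`l < n`) be monotone nonnegative functions on `α` ("bottoms" and "tops", i.e. a general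
increasing function `F_l(ε,x) = (ε ? t_l x : b_l x)` on `Bool × α` in every slot) and suppose slot `j` has a MINIMAL bottom:
`b_j · b_i = b_j · t_i` for every `i` (for indicators: `U_j⁰ ⊆ U_i⁰`).  Then
  `p · E_n^{μ}(t) + (1 − p) · E_n^{μ}(t_0,…,b_j,…,t_{n−1}) ≤ E_n^{B_p ⊗ μ}(F)`.
Proof: raising the bottoms of all slots `≠ j` only lowers `E_n` (`sahiE_pair_raise_finset_le`), and the single-defect family evaluates to the
left-hand side (`sahiE_coin_single_defect`). [this work] -/
theorem sahiE_coin_ge_of_minimal_bottom {μ : α → ℝ} (hμ₀ : ∀ x, 0 ≤ μ x) {p : ℝ} (hp₀ : 0 ≤ p) (hp₁ : p ≤ 1)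
    (hposC : ∀ k, SahiPositive (fun z : Bool × α => if z.1 then p * μ z.2 else (1 - p) * μ z.2) k)
    {n : ℕ} (b t : Fin n → α → ℝ) (hb0 : ∀ l x, 0 ≤ b l x) (hbt : ∀ l x, b l x ≤ t l x) (hbm : ∀ l, Monotone (b l))
    (htm : ∀ l, Monotone (t l)) (j : Fin n) (hmin : ∀ i x, b j x * b i x = b j x * t i x) :
    p * sahiE μ n t + (1 - p) * sahiE μ n (update t j (b j)) ≤
      sahiE (fun z : Bool × α => if z.1 then p * μ z.2 else (1 - p) * μ z.2) n
        (fun l (z : Bool × α) => if z.1 then t l z.2 else b l z.2) := by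
  match n, b, t, j, hb0, hbt, hbm, htm, hmin with
  | 0, _, _, j, _, _, _, _, _ => exact j.elim0
  | 1, b, t, j, _, _, _, _, _ =>
    have hj : j = 0 := Subsingleton.elim j 0
    subst hj
    have e : (fun l (z : Bool × α) => if z.1 then t l z.2 else b l z.2) =
        fun l (z : Bool × α) => if z.1 then t l z.2 else update t 0 (b 0) l z.2 := by
      funext l z
      have hl : l = 0 := Subsingleton.elim l 0
      subst hl
      rw [update_self]
    rw [e, sahiE_coin_single_defect]
  | k + 2, b, t, j, hb0, hbt, hbm, htm, hmin =>
    have hρ₀ := coin_nonneg hμ₀ hp₀ hp₁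
    have hraise := sahiE_pair_raise_finset_le hρ₀ hposC b t hb0 hbt hbm htm j hmin (Finset.univ.erase j)
      (Finset.notMem_erase j _)
    have e : (fun l (z : Bool × α) => if z.1 then t l z.2 else (if l ∈ Finset.univ.erase j then t l else b l) z.2) =
        fun l (z : Bool × α) => if z.1 then t l z.2 else update t j (b j) l z.2 := by
      funext l z
      by_cases hl : l = j
      · subst hl
        simp
      · have hmem : l ∈ Finset.univ.erase j := Finset.mem_erase.2 ⟨hl, Finset.mem_univ l⟩
        rw [if_pos hmem, update_of_ne hl]
    rw [e, sahiE_coin_single_defect] at hraise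
    exact hraise

/-- **Corollary (the contraction inequality `E_n ≥ p·E_n(·|top)`).**  Under the hypotheses of `sahiE_coin_ge_of_minimal_bottom` and Sahi
positivity of `μ` at order `n`: `p · E_n^{μ}(t) ≤ E_n^{B_p⊗μ}(F)`, i.e. `p ↦ E_n^{B_p⊗μ}(F)/p` does not increase when the coin is
conditioned to its top value. [this work] -/
theorem sahiE_coin_ge_mul_top_of_minimal_bottom {μ : α → ℝ} (hμ₀ : ∀ x, 0 ≤ μ x) {p : ℝ} (hp₀ : 0 ≤ p) (hp₁ : p ≤ 1)
    (hposC : ∀ k, SahiPositive (fun z : Bool × α => if z.1 then p * μ z.2 else (1 - p) * μ z.2) k)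
    {n : ℕ} (hposμ : SahiPositive μ n) (b t : Fin n → α → ℝ) (hb0 : ∀ l x, 0 ≤ b l x) (hbt : ∀ l x, b l x ≤ t l x)
    (hbm : ∀ l, Monotone (b l)) (htm : ∀ l, Monotone (t l)) (j : Fin n) (hmin : ∀ i x, b j x * b i x = b j x * t i x) :
    p * sahiE μ n t ≤
      sahiE (fun z : Bool × α => if z.1 then p * μ z.2 else (1 - p) * μ z.2) n
        (fun l (z : Bool × α) => if z.1 then t l z.2 else b l z.2) := by
  have h := sahiE_coin_ge_of_minimal_bottom hμ₀ hp₀ hp₁ hposC b t hb0 hbt hbm htm j hmin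
  have hmix : 0 ≤ sahiE μ n (update t j (b j)) := by
    refine hposμ _ (fun i x => ?_) (fun i => ?_)
    · by_cases hij : i = j
      · subst hij; rw [update_self]; exact hb0 i x
      · rw [update_of_ne hij]; exact (hb0 i x).trans (hbt i x)
    · by_cases hij : i = j
      · subst hij; rw [update_self]; exact hbm i
      · rw [update_of_ne hij]; exact htm i
  nlinarith [mul_nonneg (sub_nonneg.2 hp₁) hmix]

end Raise

/-! ### Chains: every probability weight, every order, every `p` — the tangent analogue of Blinovsky's lemma -/

section Chain

variable {α : Type*} [Fintype α] [DecidableEq α] [LinearOrder α]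

omit [DecidableEq α] in
/-- The coin product `B_p ⊗ μ` on `Bool × (finite chain)` is Sahi-positive of every order (`p ∈ [0,1]`, `μ` a probability weight): a
product weight on a product of two finite chains (`ProductChains.sahiPositive_prodWeight_linearOrder`). [this work] -/
theorem sahiPositive_coin_chain {μ : α → ℝ} (hμ₀ : ∀ x, 0 ≤ μ x) (hμ₁ : ∑ x, μ x = 1) {p : ℝ} (hp₀ : 0 ≤ p) (hp₁ : p ≤ 1)
    (k : ℕ) : SahiPositive (fun z : Bool × α => if z.1 then p * μ z.2 else (1 - p) * μ z.2) k := by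
  have hα : Nonempty α := by
    by_contra h
    rw [not_nonempty_iff] at h
    have h0 : ∑ x, μ x = 0 := Fintype.sum_empty _
    exact one_ne_zero (hμ₁.symm.trans h0)
  have e : (fun z : Bool × α => if z.1 then p * μ z.2 else (1 - p) * μ z.2) =
      fun z : Bool × α => (fun c : Bool => if c then p else 1 - p) z.1 * μ z.2 := by
    funext z; rcases z with ⟨c, x⟩; cases c <;> simp
  rw [e]
  refine ProductChains.sahiPositive_prodWeight_linearOrder (fun c : Bool => if c then p else 1 - p) μ ?_ ?_ hμ₀ hμ₁ k
  · intro c; cases c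
    · simpa using hp₁
    · simpa using hp₀
  · simp

/-- **THE CONTRACTION / TANGENT INEQUALITY ON A CHAIN AT EVERY ORDER** (the conjecture 'tangent Blinovsky' of the p2 memo
FROM-prim-sahi-p2-gen32-TANGENT §9(b), all `n`).  For a probability weight `μ` on a finite linear order `α`, `p ∈ [0,1]`, and up-sets
`U₀_l ⊆ U₁_l` (`l < n`) — so that `F_l(ε,x) = χ_{U^ε_l}(x)` is the indicator of a general up-set of `Bool × α` —
  `p · E_n^{μ}(χ_{U₁_0},…,χ_{U₁_{n−1}}) ≤ E_n^{B_p⊗μ}(F_0,…,F_{n−1})`,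
i.e. `E_n ≥ P(ε = 1)·E_n(· | ε = 1)` and `p ↦ E_n^{B_p⊗μ}(F)/p` is non-increasing; at `n = 3` this is the tree's
`sahiE_three_coin_chain_ge`, at `p → 1` it is the tangent inequality `T_n ≥ 0`.  Proof: on a chain the bottoms are nested, so some slot has
a minimal bottom, and `sahiE_coin_ge_mul_top_of_minimal_bottom` applies (Blinovsky for `μ`, product of two chains for `B_p⊗μ`). [this work] -/
theorem sahiE_coin_chain_ge {μ : α → ℝ} (hμ₀ : ∀ x, 0 ≤ μ x) (hμ₁ : ∑ x, μ x = 1) {p : ℝ} (hp₀ : 0 ≤ p) (hp₁ : p ≤ 1)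
    {n : ℕ} (U₀ U₁ : Fin n → Finset α) (hU₀ : ∀ l, IsUpperSet (U₀ l : Set α)) (hU₁ : ∀ l, IsUpperSet (U₁ l : Set α))
    (hsub : ∀ l, U₀ l ⊆ U₁ l) :
    p * sahiE μ n (fun l => setInd (U₁ l)) ≤
      sahiE (fun z : Bool × α => if z.1 then p * μ z.2 else (1 - p) * μ z.2) n
        (fun l (z : Bool × α) => if z.1 then setInd (U₁ l) z.2 else setInd (U₀ l) z.2) := by
  rcases Nat.eq_zero_or_pos n with hn | hn
  · subst hn
    rw [sahiE_zero, sahiE_zero, mul_zero]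
  · -- a slot with a bottom of minimal cardinality has a minimal bottom (up-sets of a chain are nested)
    have hne : (Finset.univ : Finset (Fin n)).Nonempty := Finset.univ_nonempty_iff.2 ⟨⟨0, hn⟩⟩
    obtain ⟨j, -, hj⟩ := Finset.exists_min_image Finset.univ (fun l => (U₀ l).card) hne
    have hmin : ∀ i, U₀ j ⊆ U₀ i := by
      intro i
      rcases (hU₀ j).total (hU₀ i) with h | h
      · exact Finset.coe_subset.1 h
      · exact (Finset.eq_of_subset_of_card_le (Finset.coe_subset.1 h) (hj i (Finset.mem_univ i))).symm.subset
    refine sahiE_coin_ge_mul_top_of_minimal_bottom hμ₀ hp₀ hp₁ (sahiPositive_coin_chain hμ₀ hμ₁ hp₀ hp₁)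
      (sahiPositive_of_linearOrder hμ₀ hμ₁ n) (fun l => setInd (U₀ l)) (fun l => setInd (U₁ l))
      (fun l x => setInd_nonneg _ x) (fun l x => ?_) (fun l => monotone_setInd (hU₀ l)) (fun l => monotone_setInd (hU₁ l)) j ?_
    · simp only [setInd_apply]
      by_cases hx : x ∈ U₀ l
      · rw [if_pos hx, if_pos (hsub l hx)]
      · rw [if_neg hx]; split_ifs <;> norm_num
    · intro i x
      simp only [setInd_apply]
      by_cases hx : x ∈ U₀ j
      · rw [if_pos hx, if_pos (hmin i hx), if_pos (hsub i (hmin i hx))]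
      · rw [if_neg hx, zero_mul, zero_mul]

end Chain

end Summit.CriticalPhenomena.PercolationContinuityZ3.Theorems.SahiTangent
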